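import Summits.Ventures.HodgeRepro.Induced

/-!
# Pohlmann's condition on a finite `G`-set (CM algebras: products of CM fields)

Blind re-derivation cell `pub-hodge-repro`, seat `typer` (gen 3).  Continues `HodgeSets.lean` /
`Induced.lean`.

The embeddings of a product `E = ∏_i K_i` of CM fields (a CM *algebra*, the endomorphism algebra of a
product of CM abelian varieties — Deligne, LNM 900, §5; the printed definition of a CM type of a CM
algebra is "a subset `Φ ⊆ Hom(E, ℂ)` containing exactly one of each conjugate pair") form the disjoint
union `⊔_i Hom(K_i, ℂ)`.  When every `K_i` embeds in one Galois CM field `K` with group `G`, this is a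
finite `G`-SET `X` (`⊔_i G ⧸ H_i`, `Induced.lean`), complex conjugation acts as the central involution `c`,
and Pohlmann's criterion (9.2.1) for a subset `Δ ⊆ X` reads `|τΔ ∩ Φ| = |τΔ ∩ cΦ|` for all `τ ∈ G`.

This file states the two notions on an arbitrary `G`-set and proves the elementary properties used
for Galois CM fields in `HodgeSets.lean` (those are the case `X = G`, definitionally):

* `IsCMTypeOn c Φ` — `Φ ⊆ X` contains exactly one of each pair `{x, c • x}`;
* `IsHodgeSetOn c Φ Δ` — Pohlmann's condition on `X`; forms `isHodgeSetOn_iff_forall_inter_eq`,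
  `isHodgeSetOn_iff_two_mul` (`2|Δ ∩ gΦ| = |Δ|`), `isHodgeSetOn_iff_forall_card_eq`;
* stability (`IsHodgeSetOn.smul`, `.conj`, `.compl`), the divisor part (`isHodgeSetOn_of_smul_eq`),
  `IsExceptionalOn`, and the counts `hodgeCountOn = divisorCountOn + exceptionalCountOn`.

The sealed statement (a), §A.3, uses exactly this on `Pt = ℤ/6 ⊔ ℤ/2` with the action `act`
(the CM algebra `F × k` of `B × E`): see `SexticBridge.lean`.
-/

open Finset
open scoped Pointwise

namespace HodgeRepro

variable {G : Type*} [Group G] {X : Type*} [MulAction G X]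

/-! ### Complex conjugation acting on a `G`-set -/

namespace IsComplexConj

variable {c : G} (hc : IsComplexConj c)
include hc

/-- Conjugating a point twice gives it back. -/
theorem smul_smul_elem (x : X) : c • c • x = x := by
  rw [smul_smul, hc.mul_self, one_smul]

/-- Conjugation moves no point onto a point's translate twice: `c • g • x = g • c • x`. -/
theorem smul_comm_elem (g : G) (x : X) : c • g • x = g • c • x := by
  rw [smul_smul, smul_smul, hc.comm]

variable [DecidableEq X]

/-- Membership in the conjugate subset of a `G`-set: `x ∈ c • Δ ↔ c • x ∈ Δ`. -/
theorem mem_smul_finset_iff_on {Δ : Finset X} {x : X} : x ∈ c • Δ ↔ c • x ∈ Δ := by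
  rw [← inv_smul_mem_iff, hc.inv_eq]

/-- Conjugating a subset of a `G`-set twice gives it back. -/
theorem smul_smul_finset_on (Δ : Finset X) : c • c • Δ = Δ := by
  rw [smul_smul, hc.mul_self, one_smul]

/-- Conjugation commutes with every translate of a subset of a `G`-set. -/
theorem smul_comm_finset_on (g : G) (Δ : Finset X) : c • g • Δ = g • c • Δ := by
  rw [smul_smul, smul_smul, hc.comm]

/-- A subset of a `G`-set is conjugation-stable iff it is closed under `x ↦ c • x`. -/
theorem smul_eq_self_iff_on {Δ : Finset X} : c • Δ = Δ ↔ ∀ x, x ∈ Δ → c • x ∈ Δ := by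
  constructor
  · intro h x hx
    rw [← hc.mem_smul_finset_iff_on, h]; exact hx
  · intro h
    ext x
    rw [hc.mem_smul_finset_iff_on]
    refine ⟨fun hx => ?_, h x⟩
    have := h _ hx
    rwa [hc.smul_smul_elem] at this

end IsComplexConj

/-! ### CM types on a `G`-set -/

/-- A *CM type* on the `G`-set `X` (relative to the conjugation `c`): a subset `Φ ⊆ X` containing
exactly one of each pair `{x, c • x}`.  For `X = G` this is `IsCMType`. -/
def IsCMTypeOn (c : G) (Φ : Finset X) : Prop :=
  ∀ x : X, x ∈ Φ ↔ c • x ∉ Φ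

/-- `IsCMTypeOn` is decidable on a finite `G`-set. -/
instance (c : G) (Φ : Finset X) [Fintype X] [DecidableEq X] : Decidable (IsCMTypeOn c Φ) := by
  unfold IsCMTypeOn; infer_instance

/-- On `X = G` (left multiplication) a CM type on the `G`-set is a CM type. -/
theorem isCMTypeOn_eq_isCMType (c : G) (Φ : Finset G) : IsCMTypeOn c Φ = IsCMType c Φ := rfl

namespace IsCMTypeOn

variable {c : G} {Φ : Finset X}

/-- At least one of `x`, `c • x` lies in a CM type. -/
theorem mem_or_conj_mem (hΦ : IsCMTypeOn c Φ) (x : X) : x ∈ Φ ∨ c • x ∈ Φ := by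
  by_cases h : x ∈ Φ
  · exact Or.inl h
  · exact Or.inr (by_contra fun h' => h ((hΦ x).2 h'))

/-- Not both `x` and `c • x` lie in a CM type. -/
theorem not_mem_and_conj_mem (hΦ : IsCMTypeOn c Φ) (x : X) : ¬ (x ∈ Φ ∧ c • x ∈ Φ) :=
  fun h => (hΦ x).1 h.1 h.2

/-- `c • x ∈ Φ ↔ x ∉ Φ` for a CM type. -/
theorem conj_mem_iff (hΦ : IsCMTypeOn c Φ) (x : X) : c • x ∈ Φ ↔ x ∉ Φ := by
  rw [hΦ x, not_not]

variable [DecidableEq X] [Fintype X]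

/-- The conjugate type `c • Φ` is the complement of `Φ`. -/
theorem smul_eq_compl (hc : IsComplexConj c) (hΦ : IsCMTypeOn c Φ) : c • Φ = Φᶜ := by
  ext x
  rw [hc.mem_smul_finset_iff_on, Finset.mem_compl]
  constructor
  · intro h hx
    exact (hΦ x).1 hx h
  · intro hx
    rcases hΦ.mem_or_conj_mem x with h | h
    · exact absurd h hx
    · exact h

/-- A CM type and its conjugate are disjoint. -/
theorem disjoint_smul (hc : IsComplexConj c) (hΦ : IsCMTypeOn c Φ) : Disjoint Φ (c • Φ) := by
  rw [hΦ.smul_eq_compl hc]; exact disjoint_compl_right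

/-- A CM type and its conjugate cover `X`. -/
theorem union_smul_eq_univ (hc : IsComplexConj c) (hΦ : IsCMTypeOn c Φ) : Φ ∪ c • Φ = univ := by
  rw [hΦ.smul_eq_compl hc, union_compl]

/-- `Φ` is a CM type on `X` iff its conjugate is its complement. -/
theorem iff_smul_eq_compl (hc : IsComplexConj c) : IsCMTypeOn c Φ ↔ c • Φ = Φᶜ := by
  refine ⟨fun hΦ => hΦ.smul_eq_compl hc, fun h x => ?_⟩
  have := Finset.ext_iff.1 h x
  rw [hc.mem_smul_finset_iff_on, Finset.mem_compl] at this
  exact ⟨fun hx hcx => this.1 hcx hx, fun hcx => by_contra fun hx => hcx (this.2 hx)⟩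

/-- Every translate of a CM type on `X` is a CM type on `X`. -/
theorem smul (hc : IsComplexConj c) (hΦ : IsCMTypeOn c Φ) (g : G) : IsCMTypeOn c (g • Φ) := by
  rw [iff_smul_eq_compl hc] at hΦ ⊢
  rw [hc.smul_comm_finset_on, hΦ]
  ext x
  rw [Finset.mem_compl, ← inv_smul_mem_iff, ← inv_smul_mem_iff, Finset.mem_compl]

/-- The conjugate of a CM type on `X` is a CM type on `X`. -/
theorem conj (hc : IsComplexConj c) (hΦ : IsCMTypeOn c Φ) : IsCMTypeOn c (c • Φ) :=
  hΦ.smul hc c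

/-- A CM type on `X` has exactly half the points of `X`. -/
theorem two_mul_card (hc : IsComplexConj c) (hΦ : IsCMTypeOn c Φ) :
    2 * Φ.card = Fintype.card X := by
  have h1 := card_union_of_disjoint (hΦ.disjoint_smul hc)
  rw [hΦ.union_smul_eq_univ hc, card_univ, card_smul_finset] at h1
  omega

end IsCMTypeOn

/-! ### Pohlmann's condition on a `G`-set -/

section Pohlmann

variable [DecidableEq X]

/-- Pohlmann's condition (9.2.1) on the `G`-set `X`: `|τΔ ∩ Φ| = |τΔ ∩ cΦ|` for every `τ ∈ G`.
For `X = G` this is `IsHodgeSet`. -/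
def IsHodgeSetOn (c : G) (Φ Δ : Finset X) : Prop :=
  ∀ τ : G, (τ • Δ ∩ Φ).card = (τ • Δ ∩ c • Φ).card

/-- Pohlmann's condition on a `G`-set is decidable for finite `G`. -/
instance (c : G) (Φ Δ : Finset X) [Fintype G] : Decidable (IsHodgeSetOn c Φ Δ) := by
  unfold IsHodgeSetOn; infer_instance

/-- `⟨Δ⟩` is *exceptional* on `X`: Pohlmann's condition holds but `Δ` is not conjugation-stable. -/
def IsExceptionalOn (c : G) (Φ Δ : Finset X) : Prop :=
  IsHodgeSetOn c Φ Δ ∧ c • Δ ≠ Δ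

/-- `IsExceptionalOn` is decidable for finite `G`. -/
instance (c : G) (Φ Δ : Finset X) [Fintype G] : Decidable (IsExceptionalOn c Φ Δ) := by
  unfold IsExceptionalOn; infer_instance

/-- Translating `Δ` by `τ` and intersecting with `Φ` is intersecting `Δ` with `τ⁻¹ • Φ`. -/
theorem card_smul_inter_on (τ : G) (Δ Φ : Finset X) :
    (τ • Δ ∩ Φ).card = (Δ ∩ τ⁻¹ • Φ).card := by
  conv_lhs => rw [← smul_inv_smul τ Φ, ← smul_finset_inter, card_smul_finset]

/-- Pohlmann's condition in the "pairing" form: `|Δ ∩ gΦ| = |Δ ∩ g cΦ|` for all `g ∈ G`. -/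
theorem isHodgeSetOn_iff_forall_inter_eq (c : G) (Φ Δ : Finset X) :
    IsHodgeSetOn c Φ Δ ↔ ∀ g : G, (Δ ∩ g • Φ).card = (Δ ∩ g • c • Φ).card := by
  constructor
  · intro h g
    have := h g⁻¹
    rwa [card_smul_inter_on, card_smul_inter_on, inv_inv] at this
  · intro h τ
    rw [card_smul_inter_on, card_smul_inter_on]
    exact h τ⁻¹

/-- Pohlmann's condition is stable under the `G`-action on subsets. -/
theorem IsHodgeSetOn.smul {c : G} {Φ Δ : Finset X} (h : IsHodgeSetOn c Φ Δ) (g : G) :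
    IsHodgeSetOn c Φ (g • Δ) := by
  intro τ
  rw [smul_smul]
  exact h (τ * g)

/-- Pohlmann's condition is stable under conjugation of the subset. -/
theorem IsHodgeSetOn.conj {c : G} {Φ Δ : Finset X} (h : IsHodgeSetOn c Φ Δ) :
    IsHodgeSetOn c Φ (c • Δ) :=
  h.smul c

/-- A conjugation-stable subset satisfies Pohlmann's condition (the divisor-generated classes). -/
theorem isHodgeSetOn_of_smul_eq {c : G} {Φ Δ : Finset X} (hc : IsComplexConj c) (hΔ : c • Δ = Δ) :
    IsHodgeSetOn c Φ Δ := by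
  intro τ
  have : τ • Δ ∩ c • Φ = c • (τ • Δ ∩ Φ) := by
    rw [smul_finset_inter, hc.smul_comm_finset_on, hΔ]
  rw [this, card_smul_finset]

/-- The empty subset satisfies Pohlmann's condition. -/
theorem isHodgeSetOn_empty (c : G) (Φ : Finset X) : IsHodgeSetOn c Φ ∅ := by
  intro τ; simp

variable [Fintype X]

/-- The two Hodge numbers of `⟨Δ⟩` add up to `|Δ|` (for a CM type on `X`). -/
theorem card_inter_add_card_inter_conj {c : G} {Φ : Finset X} (hc : IsComplexConj c)
    (hΦ : IsCMTypeOn c Φ) (Δ : Finset X) : (Δ ∩ Φ).card + (Δ ∩ c • Φ).card = Δ.card := by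
  rw [hΦ.smul_eq_compl hc, ← sdiff_eq_inter_compl, card_inter_add_card_sdiff]

/-- Pohlmann's condition in "half-degree" form: `2·|Δ ∩ gΦ| = |Δ|` for all `g ∈ G`. -/
theorem isHodgeSetOn_iff_two_mul {c : G} {Φ : Finset X} (hc : IsComplexConj c)
    (hΦ : IsCMTypeOn c Φ) (Δ : Finset X) :
    IsHodgeSetOn c Φ Δ ↔ ∀ g : G, 2 * (Δ ∩ g • Φ).card = Δ.card := by
  rw [isHodgeSetOn_iff_forall_inter_eq]
  refine forall_congr' fun g => ?_
  have h := card_inter_add_card_inter_conj hc (hΦ.smul hc g) Δ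
  rw [hc.smul_comm_finset_on] at h
  omega

/-- Pohlmann's condition in "weight" form: `|Δ ∩ gΦ| = p` for all `g`, where `|Δ| = 2p`. -/
theorem isHodgeSetOn_iff_forall_card_eq {c : G} {Φ : Finset X} (hc : IsComplexConj c)
    (hΦ : IsCMTypeOn c Φ) (Δ : Finset X) (p : ℕ) (hΔ : Δ.card = 2 * p) :
    IsHodgeSetOn c Φ Δ ↔ ∀ g : G, (Δ ∩ g • Φ).card = p := by
  rw [isHodgeSetOn_iff_two_mul hc hΦ, hΔ]
  exact forall_congr' fun g => by omega

/-- A Pohlmann subset of a `G`-set has even cardinality. -/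
theorem IsHodgeSetOn.even_card {c : G} {Φ Δ : Finset X} (hc : IsComplexConj c) (hΦ : IsCMTypeOn c Φ)
    (h : IsHodgeSetOn c Φ Δ) : Even Δ.card := by
  rw [isHodgeSetOn_iff_two_mul hc hΦ] at h
  exact ⟨(Δ ∩ (1 : G) • Φ).card, by rw [← h 1]; ring⟩

/-- The complement of a Pohlmann subset is a Pohlmann subset. -/
theorem IsHodgeSetOn.compl {c : G} {Φ Δ : Finset X} (hc : IsComplexConj c) (hΦ : IsCMTypeOn c Φ)
    (h : IsHodgeSetOn c Φ Δ) : IsHodgeSetOn c Φ Δᶜ := by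
  rw [isHodgeSetOn_iff_two_mul hc hΦ] at h ⊢
  intro g
  have hg := (hΦ.smul hc g).two_mul_card hc
  have h1 : (Δᶜ ∩ g • Φ).card + (Δ ∩ g • Φ).card = (g • Φ).card := by
    rw [inter_comm, inter_comm Δ, ← sdiff_eq_inter_compl, card_sdiff_add_card_inter]
  have h2 := card_compl Δ
  rw [card_smul_finset] at hg h1
  have h3 := h g
  omega

/-- `X` itself satisfies Pohlmann's condition. -/
theorem isHodgeSetOn_univ {c : G} {Φ : Finset X} (hc : IsComplexConj c) (hΦ : IsCMTypeOn c Φ) :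
    IsHodgeSetOn c Φ univ := by
  simpa using (isHodgeSetOn_empty c Φ).compl hc hΦ

variable [Fintype G]

/-- The number of Pohlmann subsets of size `2p` of the `G`-set `X`. -/
def hodgeCountOn (c : G) (Φ : Finset X) (p : ℕ) : ℕ :=
  (univ.filter fun Δ : Finset X => Δ.card = 2 * p ∧ IsHodgeSetOn c Φ Δ).card

/-- The number of conjugation-stable subsets of size `2p` of the `G`-set `Y` (explicit, as it does not
depend on a CM type). -/
def divisorCountOn (Y : Type*) [Fintype Y] [DecidableEq Y] [MulAction G Y] (c : G) (p : ℕ) : ℕ :=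
  (univ.filter fun Δ : Finset Y => Δ.card = 2 * p ∧ c • Δ = Δ).card

/-- The number of exceptional subsets of size `2p` of `X`. -/
def exceptionalCountOn (c : G) (Φ : Finset X) (p : ℕ) : ℕ :=
  (univ.filter fun Δ : Finset X => Δ.card = 2 * p ∧ IsExceptionalOn c Φ Δ).card

/-- `hodgeCountOn = divisorCountOn + exceptionalCountOn`. -/
theorem hodgeCountOn_eq_add {c : G} {Φ : Finset X} (hc : IsComplexConj c) (p : ℕ) :
    hodgeCountOn c Φ p = divisorCountOn X c p + exceptionalCountOn c Φ p := by
  unfold hodgeCountOn divisorCountOn exceptionalCountOn IsExceptionalOn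
  rw [← card_union_of_disjoint]
  · congr 1
    ext Δ
    simp only [mem_filter, mem_univ, true_and, mem_union]
    constructor
    · rintro ⟨h1, h2⟩
      by_cases h : c • Δ = Δ
      · exact Or.inl ⟨h1, h⟩
      · exact Or.inr ⟨h1, h2, h⟩
    · rintro (⟨h1, h2⟩ | ⟨h1, h2, _⟩)
      · exact ⟨h1, isHodgeSetOn_of_smul_eq hc h2⟩
      · exact ⟨h1, h2⟩
  · rw [disjoint_left]
    intro Δ h1 h2
    simp only [mem_filter, mem_univ, true_and] at h1 h2
    exact h2.2.2 h1.2

end Pohlmann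

/-! ### The case `X = G`: the notions of `HodgeSets.lean` -/

section Galois

variable [DecidableEq G]

/-- On `X = G` Pohlmann's condition on the `G`-set is Pohlmann's condition of `HodgeSets.lean`. -/
theorem isHodgeSetOn_eq_isHodgeSet (c : G) (Φ Δ : Finset G) :
    IsHodgeSetOn c Φ Δ = IsHodgeSet c Φ Δ := rfl

/-- On `X = G` the exceptional subsets are those of `HodgeSets.lean`. -/
theorem isExceptionalOn_eq_isExceptional (c : G) (Φ Δ : Finset G) :
    IsExceptionalOn c Φ Δ = IsExceptional c Φ Δ := rfl

variable [Fintype G]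

/-- On `X = G` the Hodge count on the `G`-set is `hodgeCount`. -/
theorem hodgeCountOn_eq_hodgeCount (c : G) (Φ : Finset G) (p : ℕ) :
    hodgeCountOn c Φ p = hodgeCount c Φ p := by
  unfold hodgeCountOn hodgeCount; congr

/-- On `X = G` the exceptional count on the `G`-set is `exceptionalCount`. -/
theorem exceptionalCountOn_eq_exceptionalCount (c : G) (Φ : Finset G) (p : ℕ) :
    exceptionalCountOn c Φ p = exceptionalCount c Φ p := by
  unfold exceptionalCountOn exceptionalCount; congr

end Galois

end HodgeRepro
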